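import Mathlib
import Summits.ValiantsHypothesis.ValiantsHypothesis.Theorems.GirthSidonMomentCurveElusiveDepthMatroid

/-!
# The unit-norm valuation behind 2×2 cancellations (supports `stub_swallowedInSmallSumset`,
crux `MomentCurveElusive`, item stmt-ValiantsHypothesis-6534, route GirthSidon, line `registered`)

Setting (crux directory, LEAD-ANALYSIS-c4/c5): sources `y_j = t^{o_j} u_j ∈ ℂ((t))`, `u_j ∈ ℂ⟦t⟧`,
`u_j(0) = 1`; a cancelling 2×2 combination `y_a y_b − y_c y_d` with balanced weights
`o_a + o_b = o_c + o_d = w` equals `t^w (u_a u_b − u_c u_d)`, and its *depth* is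
`γ = ord(u_a u_b − u_c u_d)`.  The landed circuit law (`gadget_minDepth_attained_twice`, p164537)
treats EXACT gadgets `u_a u_b − u_c u_d = κ t^γ`.  On the line one also needs *generalised* gadgets —
the leading 2×2 cancellation of a target that is afterwards cleaned by further (honest or cancelling)
products of higher weight — for which only the ORDER `ord(u_a u_b − u_c u_d) = γ` is known.

This file isolates the structure that governs all of them: the **unit norm**
  `ν(x) = ord(u^x − 1)`,  `u^x = ∏_j u_j^{x_j}`,  `x ∈ ℤ^n`,
on the character lattice of the sources.  We prove, for units with constant term `1` over a field of
characteristic zero,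

* `min_order_sub_one_le_order_mul_sub_one`, `order_inv_sub_one`, `order_zpow_sub_one` — `ν` is an
  ultrametric, even, and HOMOGENEOUS norm: `ν(x + y) ≥ min(ν x, ν y)`, `ν(−x) = ν(x)`, `ν(k x) = ν(x)`
  for `k ≠ 0` (so the balls `{ν ≥ g}` are PURE sublattices: a flag of saturated subgroups of `ℤ^n`,
  hence at most `n` finite values — the "flag law");
* `order_gadget_eq_order_ratio_sub_one` — the depth of a (generalised) gadget is the norm of its
  signed incidence vector: `ord(u_a u_b − u_c u_d) = ν(e_a + e_b − e_c − e_d)`;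
* `generalisedGadget_minDepth_attained_twice` — consequently the circuit law holds for generalised
  gadgets (hypothesis on orders only): on every `ℤ`-dependency of the incidence vectors the minimal
  depth is attained twice; and `card_generalisedGadgetDepths_le` — at most `n` distinct depths;
* `exists_depthSet_of_generalisedTwoByTwo` — the born exponents `D_i = o_{a_i} + o_{b_i} + γ_i` of
  targets initiated by generalised 2×2 cancellations lie in `O + O + G` with `|G| ≤ n`.

Proofs: `pq − 1 = (p − 1)q + (q − 1)`; `p^l − 1 = (p − 1)(1 + p + ⋯ + p^{l−1})` and the geometric sum
has constant term `l ≠ 0` (characteristic zero), `p^{−1} − 1 = −p^{−1}(p − 1)`; a dependency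
`Σ μ_i ε_i = 0` gives `R_{i₀}^{μ_{i₀}} = (∏_{i ≠ i₀} R_i^{μ_i})^{−1}` for the gadget ratios
`R_i = u_a u_b / (u_c u_d)` (landed `prod_gadgetRatio_zpow_eq_one`), whose two sides have norms
`γ_{i₀}` and `≥ min_{i ≠ i₀, μ_i ≠ 0} γ_i` respectively.
-/

-- (Sub = Summit), so the duplicated namespace component is intended.
set_option linter.dupNamespace false

namespace Summit.ValiantsHypothesis.ValiantsHypothesis.Theorems

open PowerSeries Finset

section UnitNorm

variable {K : Type*} [Field K]

/-- **Ultrametric inequality for the unit norm.** For units `p, q` of `K⟦X⟧`,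
`ord(pq − 1) ≥ min(ord(p − 1), ord(q − 1))`, since `pq − 1 = (p − 1)q + (q − 1)`. [folklore] -/
theorem min_order_sub_one_le_order_mul_sub_one (p q : K⟦X⟧ˣ) :
    min (((p : K⟦X⟧) - 1).order) (((q : K⟦X⟧) - 1).order) ≤
      (((p * q : K⟦X⟧ˣ) : K⟦X⟧) - 1).order := by
  have h : ((p * q : K⟦X⟧ˣ) : K⟦X⟧) - 1 = ((p : K⟦X⟧) - 1) * (q : K⟦X⟧) + ((q : K⟦X⟧) - 1) := by
    rw [Units.val_mul]; ring
  rw [h]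
  refine le_trans ?_ (min_order_le_order_add _ _)
  rw [order_mul, order_zero_of_unit (Units.isUnit q), add_zero]

/-- **The unit norm is even.** `ord(p⁻¹ − 1) = ord(p − 1)` for a unit `p` of `K⟦X⟧`
(`p⁻¹ − 1 = −p⁻¹ (p − 1)`). [folklore] -/
theorem order_inv_sub_one (p : K⟦X⟧ˣ) :
    (((p⁻¹ : K⟦X⟧ˣ) : K⟦X⟧) - 1).order = ((p : K⟦X⟧) - 1).order := by
  have h : ((p⁻¹ : K⟦X⟧ˣ) : K⟦X⟧) - 1 = -(((p⁻¹ : K⟦X⟧ˣ) : K⟦X⟧) * ((p : K⟦X⟧) - 1)) := by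
    rw [mul_sub, Units.inv_mul, mul_one]; ring
  rw [h, order_neg, order_mul, order_zero_of_unit (Units.isUnit _), zero_add]

/-- **Iterated ultrametric inequality.** If every factor `q_i` (`i ∈ s`) has `ord(q_i − 1) ≥ g`,
then `ord(∏_{i∈s} q_i − 1) ≥ g`. [folklore] -/
theorem le_order_prod_sub_one {ι : Type*} (s : Finset ι) (q : ι → K⟦X⟧ˣ) (g : ℕ∞)
    (h : ∀ i ∈ s, g ≤ (((q i : K⟦X⟧ˣ) : K⟦X⟧) - 1).order) :
    g ≤ (((∏ i ∈ s, q i : K⟦X⟧ˣ) : K⟦X⟧) - 1).order := by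
  classical
  induction s using Finset.induction_on with
  | empty => simp
  | insert a s ha ih =>
      rw [Finset.prod_insert ha]
      refine le_trans ?_ (min_order_sub_one_le_order_mul_sub_one _ _)
      exact le_min (h a (mem_insert_self a s)) (ih fun i hi => h i (mem_insert_of_mem hi))

/-- **Homogeneity in natural exponents.** In characteristic zero, for a unit `p` with constant term
`1` and `l ≠ 0`, `ord(p^l − 1) = ord(p − 1)`: indeed `p^l − 1 = (p − 1)(1 + p + ⋯ + p^{l−1})` and the
geometric sum has constant term `l`, a unit. [folklore] -/
theorem order_pow_sub_one [CharZero K] (p : K⟦X⟧ˣ) (hp : constantCoeff (p : K⟦X⟧) = 1)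
    {l : ℕ} (hl : l ≠ 0) :
    (((p ^ l : K⟦X⟧ˣ) : K⟦X⟧) - 1).order = ((p : K⟦X⟧) - 1).order := by
  have hgeom : (∑ i ∈ range l, (p : K⟦X⟧) ^ i) * ((p : K⟦X⟧) - 1) = (p : K⟦X⟧) ^ l - 1 :=
    geom_sum_mul _ _
  have hunit : IsUnit (∑ i ∈ range l, (p : K⟦X⟧) ^ i) := by
    rw [isUnit_iff_constantCoeff, map_sum]
    simp only [map_pow, hp, one_pow, sum_const, card_range, nsmul_eq_mul, mul_one]
    exact isUnit_iff_ne_zero.mpr (Nat.cast_ne_zero.mpr hl)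
  rw [Units.val_pow_eq_pow_val, ← hgeom, order_mul, order_zero_of_unit hunit, zero_add]

/-- **Homogeneity of the unit norm.** In characteristic zero, for a unit `p` with constant term `1`
and an integer `k ≠ 0`, `ord(p^k − 1) = ord(p − 1)`.  Consequently the balls `{x : ord(u^x − 1) ≥ g}`
of the unit norm on `ℤ^n` are saturated subgroups (a flag of pure sublattices). [folklore] -/
theorem order_zpow_sub_one [CharZero K] (p : K⟦X⟧ˣ) (hp : constantCoeff (p : K⟦X⟧) = 1)
    {k : ℤ} (hk : k ≠ 0) :
    (((p ^ k : K⟦X⟧ˣ) : K⟦X⟧) - 1).order = ((p : K⟦X⟧) - 1).order := by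
  rcases Int.eq_nat_or_neg k with ⟨l, rfl | rfl⟩
  · have hl : l ≠ 0 := by rintro rfl; simp at hk
    rw [zpow_natCast]
    exact order_pow_sub_one p hp hl
  · have hl : l ≠ 0 := by rintro rfl; simp at hk
    rw [zpow_neg, zpow_natCast, order_inv_sub_one]
    exact order_pow_sub_one p hp hl

/-- **Gadget depth = unit norm of the incidence vector.** For units `u_a, u_b, u_c, u_d` of `K⟦X⟧`,
`ord(u_a u_b − u_c u_d) = ord(u_a u_b (u_c u_d)⁻¹ − 1)`, because
`u_a u_b − u_c u_d = u_c u_d · (u_a u_b (u_c u_d)⁻¹ − 1)` and `u_c u_d` is a unit. [folklore] -/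
theorem order_gadget_eq_order_ratio_sub_one (ua ub uc ud : K⟦X⟧ˣ) :
    ((ua : K⟦X⟧) * ub - uc * ud).order =
      ((((ua * ub / (uc * ud) : K⟦X⟧ˣ)) : K⟦X⟧) - 1).order := by
  have hgrp : (uc * ud) * (ua * ub / (uc * ud)) = ua * ub := mul_div_cancel (uc * ud) (ua * ub)
  have h : ((uc * ud : K⟦X⟧ˣ) : K⟦X⟧) * ((((ua * ub / (uc * ud) : K⟦X⟧ˣ)) : K⟦X⟧) - 1) =
      (ua : K⟦X⟧) * ub - uc * ud := by
    rw [mul_sub, mul_one, ← Units.val_mul, hgrp, Units.val_mul, Units.val_mul]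
  rw [← h, order_mul, order_zero_of_unit (Units.isUnit _), zero_add]

/-- Constant term of the inverse of a unit with constant term `1`. [folklore] -/
theorem constantCoeff_units_inv_of_eq_one (p : K⟦X⟧ˣ) (hp : constantCoeff (p : K⟦X⟧) = 1) :
    constantCoeff ((p⁻¹ : K⟦X⟧ˣ) : K⟦X⟧) = 1 := by
  have h := congrArg constantCoeff (p.mul_inv : (p : K⟦X⟧) * ↑p⁻¹ = 1)
  rwa [map_mul, hp, one_mul, map_one] at h

/-- **Circuit law for generalised 2×2 gadgets** (hypothesis on ORDERS only).  Let
`u_1, …, u_n ∈ K⟦X⟧` have constant term `1` over a field of characteristic zero, and let `m`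
quadruples `(a_i, b_i; c_i, d_i)` have `ord(u_{a_i} u_{b_i} − u_{c_i} u_{d_i}) = γ_i` (finite).  If
integer weights `μ` annihilate the signed incidence vectors `e_{a_i} + e_{b_i} − e_{c_i} − e_{d_i}` and
`μ_{i₀} ≠ 0`, then some other `i ≠ i₀` with `μ_i ≠ 0` has `γ_i ≤ γ_{i₀}`.  (Generalises
`gadget_minDepth_attained_twice`, where the differences are exact monomials; this is the form needed
for cancellations that are subsequently cleaned by higher-weight products.) [folklore] -/
theorem generalisedGadget_minDepth_attained_twice [CharZero K] {n m : ℕ}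
    (u : Fin n → K⟦X⟧) (hu : ∀ j, constantCoeff (u j) = 1)
    (a b c d : Fin m → Fin n) (γ : Fin m → ℕ)
    (hgad : ∀ i, (u (a i) * u (b i) - u (c i) * u (d i)).order = γ i)
    (μ : Fin m → ℤ)
    (hdep : ∀ j : Fin n, ∑ i : Fin m, μ i *
      (((if a i = j then (1 : ℤ) else 0) + (if b i = j then 1 else 0)) -
        ((if c i = j then 1 else 0) + (if d i = j then 1 else 0))) = 0)
    (i₀ : Fin m) (hi₀ : μ i₀ ≠ 0) :
    ∃ i : Fin m, i ≠ i₀ ∧ μ i ≠ 0 ∧ γ i ≤ γ i₀ := by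
  by_contra H
  push Not at H
  -- the sources as units
  have hunit : ∀ j, IsUnit (u j) := by
    intro j
    rw [PowerSeries.isUnit_iff_constantCoeff, hu j]
    exact isUnit_one
  set U : Fin n → K⟦X⟧ˣ := fun j => (hunit j).unit with hU
  have hUval : ∀ j, ((U j : K⟦X⟧ˣ) : K⟦X⟧) = u j := fun j => (hunit j).unit_spec
  have hUcc : ∀ j, constantCoeff ((U j : K⟦X⟧ˣ) : K⟦X⟧) = 1 := fun j => by rw [hUval]; exact hu j
  -- the gadget ratios
  set R : Fin m → K⟦X⟧ˣ := fun i => (U (a i) * U (b i)) / (U (c i) * U (d i)) with hR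
  have hRcc : ∀ i, constantCoeff ((R i : K⟦X⟧ˣ) : K⟦X⟧) = 1 := by
    intro i
    simp only [hR, div_eq_mul_inv, mul_inv, Units.val_mul, map_mul, hUcc,
      constantCoeff_units_inv_of_eq_one _ (hUcc _), mul_one]
  have hRord : ∀ i, (((R i : K⟦X⟧ˣ) : K⟦X⟧) - 1).order = γ i := by
    intro i
    rw [← hgad i, ← hUval, ← hUval, ← hUval, ← hUval]
    exact (order_gadget_eq_order_ratio_sub_one _ _ _ _).symm
  -- the product identity on the dependency, with `i₀` isolated
  have hprod : ∏ i : Fin m, (R i) ^ (μ i) = 1 := prod_gadgetRatio_zpow_eq_one U a b c d μ hdep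
  have hsplit : (R i₀) ^ (μ i₀) = (∏ i ∈ univ.erase i₀, (R i) ^ (μ i))⁻¹ := by
    rw [← Finset.mul_prod_erase univ (fun i => (R i) ^ (μ i)) (mem_univ i₀)] at hprod
    exact eq_inv_of_mul_eq_one_left hprod
  -- norm of the left-hand side
  have h1 : ((((R i₀) ^ (μ i₀) : K⟦X⟧ˣ) : K⟦X⟧) - 1).order = γ i₀ := by
    rw [order_zpow_sub_one _ (hRcc i₀) hi₀, hRord]
  -- norm of the right-hand side
  have h2 : ((γ i₀ + 1 : ℕ) : ℕ∞) ≤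
      ((((∏ i ∈ univ.erase i₀, (R i) ^ (μ i))⁻¹ : K⟦X⟧ˣ) : K⟦X⟧) - 1).order := by
    rw [order_inv_sub_one]
    apply le_order_prod_sub_one
    intro i hi
    rw [mem_erase] at hi
    by_cases hμ : μ i = 0
    · simp [hμ]
    · rw [order_zpow_sub_one _ (hRcc i) hμ, hRord i]
      exact_mod_cast H i hi.1 hμ
  rw [← hsplit, h1] at h2
  have h3 : γ i₀ + 1 ≤ γ i₀ := by exact_mod_cast h2
  omega

/-- **At most `n` distinct depths for generalised gadgets.** Under the hypotheses of
`generalisedGadget_minDepth_attained_twice` (orders only), the depths `γ_i` take at most `n` distinct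
values: a transversal of the depth values is `ℤ`-linearly independent in `ℤ^n` by the circuit law.
[folklore] -/
theorem card_generalisedGadgetDepths_le [CharZero K] {n m : ℕ}
    (u : Fin n → K⟦X⟧) (hu : ∀ j, constantCoeff (u j) = 1)
    (a b c d : Fin m → Fin n) (γ : Fin m → ℕ)
    (hgad : ∀ i, (u (a i) * u (b i) - u (c i) * u (d i)).order = γ i) :
    (Finset.univ.image γ).card ≤ n := by
  classical
  -- the signed incidence vectors
  set ε : Fin m → (Fin n → ℤ) := fun i j =>
    ((if a i = j then (1 : ℤ) else 0) + (if b i = j then 1 else 0)) -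
      ((if c i = j then 1 else 0) + (if d i = j then 1 else 0)) with hε
  -- a transversal of the depth values
  set vals : Finset ℕ := Finset.univ.image γ with hvals
  have hsel : ∀ v : vals, ∃ i : Fin m, γ i = v := by
    rintro ⟨v, hv⟩
    obtain ⟨i, -, hi⟩ := Finset.mem_image.1 hv
    exact ⟨i, hi⟩
  choose sel hsel using hsel
  have hsel_inj : Function.Injective sel := by
    intro v w h
    apply Subtype.ext
    rw [← hsel v, ← hsel w, h]
  -- the transversal is linearly independent over `ℤ`
  have hli : LinearIndependent ℤ (fun v : vals => ε (sel v)) := by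
    rw [linearIndependent_iff']
    intro s g hsum
    by_contra hne
    push Not at hne
    obtain ⟨v₀, hv₀, hmin⟩ := Finset.exists_min_image (s.filter fun v => g v ≠ 0)
      (fun v : vals => (v : ℕ)) (by
        obtain ⟨v, hv, hgv⟩ := hne
        exact ⟨v, Finset.mem_filter.2 ⟨hv, hgv⟩⟩)
    rw [Finset.mem_filter] at hv₀
    set μ : Fin m → ℤ := fun i => ∑ v ∈ s, if sel v = i then g v else 0 with hμ
    have hμsel : ∀ v ∈ s, μ (sel v) = g v := by
      intro v hv
      rw [hμ]
      simp only
      rw [Finset.sum_eq_single v]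
      · simp
      · intro w _ hw
        rw [if_neg fun h => hw (hsel_inj h)]
      · intro hv'; exact absurd hv hv'
    have hμoff : ∀ i, (∀ v ∈ s, sel v ≠ i) → μ i = 0 := by
      intro i hi
      rw [hμ]
      exact Finset.sum_eq_zero fun v hv => by simp [hi v hv]
    have hdep : ∀ j : Fin n, ∑ i : Fin m, μ i * ε i j = 0 := by
      intro j
      have hj := congrFun hsum j
      simp only [Finset.sum_apply, Pi.smul_apply, smul_eq_mul, Pi.zero_apply] at hj
      rw [← hj]
      simp only [hμ, Finset.sum_mul]
      rw [Finset.sum_comm]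
      refine Finset.sum_congr rfl fun v hv => ?_
      rw [Finset.sum_eq_single (sel v)]
      · simp
      · intro i _ hi; simp [Ne.symm hi]
      · simp
    obtain ⟨i, hi, hμi, hγi⟩ := generalisedGadget_minDepth_attained_twice u hu a b c d γ hgad μ
      (by simpa [hε] using hdep) (sel v₀) (by rw [hμsel v₀ hv₀.1]; exact hv₀.2)
    obtain ⟨w, hw, rfl⟩ : ∃ w ∈ s, sel w = i := by
      by_contra hno
      push Not at hno
      exact hμi (hμoff i hno)
    have hgw : g w ≠ 0 := by rwa [hμsel w hw] at hμi
    have hle : (w : ℕ) ≤ (v₀ : ℕ) := by rw [← hsel w, ← hsel v₀]; exact hγi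
    have hge : (v₀ : ℕ) ≤ (w : ℕ) := hmin w (Finset.mem_filter.2 ⟨hw, hgw⟩)
    exact hi (congrArg sel (Subtype.ext (le_antisymm hle hge)))
  have hcard := hli.fintype_card_le_finrank
  rw [Module.finrank_fin_fun ℤ, Fintype.card_coe] at hcard
  exact hcard

/-- **Born exponents of generalised 2×2 cancellations lie in `O + O + G`, `|G| ≤ n`.**  Sources
`y_j = X^{o_j} u_j` (`u_j(0) = 1`) over a field of characteristic zero; suppose each of `m` born
targets `D_i` is INITIATED by a 2×2 cancellation at the balanced weight
`o_{a_i} + o_{b_i} = o_{c_i} + o_{d_i} < D_i` whose leading term survives: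
`ord(u_{a_i} u_{b_i} − u_{c_i} u_{d_i}) = D_i − (o_{a_i} + o_{b_i})` (exact gadgets, and gadgets
cleaned by higher-weight products, both satisfy this).  Then there is `G ⊂ ℕ` with `|G| ≤ n` and
`D_i ∈ o_{a_i} + o_{b_i} + G` for all `i`. [folklore] -/
theorem exists_depthSet_of_generalisedTwoByTwo [CharZero K] {n m : ℕ}
    (o : Fin n → ℕ) (u : Fin n → K⟦X⟧) (hu : ∀ j, constantCoeff (u j) = 1)
    (a b c d : Fin m → Fin n) (D : Fin m → ℕ)
    (hborn : ∀ i, o (a i) + o (b i) < D i)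
    (hgad : ∀ i, (u (a i) * u (b i) - u (c i) * u (d i)).order = (D i - (o (a i) + o (b i)) : ℕ)) :
    ∃ G : Finset ℕ, G.card ≤ n ∧ ∀ i, ∃ γ ∈ G, D i = o (a i) + o (b i) + γ := by
  classical
  set γ : Fin m → ℕ := fun i => D i - (o (a i) + o (b i)) with hγdef
  have hD : ∀ i, D i = o (a i) + o (b i) + γ i := fun i => by
    have := hborn i; simp only [hγdef]; omega
  refine ⟨Finset.univ.image γ, card_generalisedGadgetDepths_le u hu a b c d γ hgad,
    fun i => ⟨γ i, Finset.mem_image_of_mem _ (mem_univ _), hD i⟩⟩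

end UnitNorm

/-- **Registered helper stub `helper_generalisedCircuitLaw`** (crux stmt-ValiantsHypothesis-6534,
line `registered`): the circuit law for generalised 2×2 gadgets over `ℂ` — hypothesis on the ORDER
of `u_a u_b − u_c u_d` only — spelled out with all binders. [folklore] -/
theorem helper_generalisedCircuitLaw : ∀ (n m : ℕ) (u : Fin n → PowerSeries ℂ) (a b c d : Fin m → Fin n) (γ : Fin m → ℕ) (μ : Fin m → ℤ) (i₀ : Fin m), (∀ j, PowerSeries.constantCoeff (u j) = 1) → (∀ i, (u (a i) * u (b i) - u (c i) * u (d i)).order = (γ i : ℕ∞)) → (∀ j : Fin n, ∑ i : Fin m, μ i * (((if a i = j then (1 : ℤ) else 0) + (if b i = j then 1 else 0)) - ((if c i = j then 1 else 0) + (if d i = j then 1 else 0))) = 0) → μ i₀ ≠ 0 → ∃ i : Fin m, i ≠ i₀ ∧ μ i ≠ 0 ∧ γ i ≤ γ i₀ :=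
  fun _ _ u a b c d γ μ i₀ hu hgad hdep hi₀ =>
    generalisedGadget_minDepth_attained_twice u hu a b c d γ hgad μ hdep i₀ hi₀

/-- **Registered helper stub `helper_generalisedDepthSet`** (crux stmt-ValiantsHypothesis-6534,
line `registered`): `exists_depthSet_of_generalisedTwoByTwo` over `ℂ`, spelled out with all
binders — born exponents initiated by generalised 2×2 cancellations lie in `O + O + G`, `|G| ≤ n`.
[folklore] -/
theorem helper_generalisedDepthSet : ∀ (n m : ℕ) (o : Fin n → ℕ) (u : Fin n → PowerSeries ℂ) (a b c d : Fin m → Fin n) (D : Fin m → ℕ), (∀ j, PowerSeries.constantCoeff (u j) = 1) → (∀ i, o (a i) + o (b i) < D i) → (∀ i, (u (a i) * u (b i) - u (c i) * u (d i)).order = ((D i - (o (a i) + o (b i)) : ℕ) : ℕ∞)) → ∃ G : Finset ℕ, G.card ≤ n ∧ ∀ i, ∃ γ ∈ G, D i = o (a i) + o (b i) + γ :=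
  fun _ _ o u a b c d D hu hborn hgad =>
    exists_depthSet_of_generalisedTwoByTwo o u hu a b c d D hborn hgad

end Summit.ValiantsHypothesis.ValiantsHypothesis.Theorems
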